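import Literature.AnabelianGeometry.SemiGraphs.PSCEdgeLikeCharacterizationReduction
import Literature.AnabelianGeometry.SemiGraphs.PSCIrreducibleNodalOrigin
import Literature.AnabelianGeometry.SemiGraphs.ProSigmaCompletionTFG
import HarnessLib

/-!
# [IUTchI] Rmk. 1.2.3 (v) HOLDS at genuine IRREDUCIBLE ONE-NODAL data (one vertex with a loop)

Mochizuki, *Inter-universal Teichmüller theory I* [IUTchI] Rmk. 1.2.3 (v), kurims manuscript p. 43: for
`G` of pro-`Σ` PSC-type, `Σ = {l}`, noncuspidal, "the nodal edge-like subgroups of `Π_G` may be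
characterized as the maximal closed subgroups `A ⊆ Π_G` isomorphic to `ℤ_l` which satisfy the following
condition: for every characteristic open subgroup `Π_{G'} ⊆ Π_G` … the cyclic finite étale covering
`G' → G''` is nodally totally ramified …" [cite: Mochizuki2012, IUTchI Rmk 1.2.3(v) p.43] — abc-iut
FACT-LIST row F-1937 (`PSCDatum.NodalEdgeLikeCharacterizationHolds`, typed by abc-iut-L3-t4).
PROOF-ONLY file (abc-iut-w5-d160, D-0079 L-F row F-1937; no definitions).  Sequel to
`PSCNodalCharacterizationTwoComponent.lean` (the separating node, stratum `Δ_h`): here the OTHER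
codimension-one degeneration, abc-iut-f-164's DATA OF IRREDUCIBLE ONE-NODAL SHAPE
(`PSCIrreducibleNodalShape.lean` / `PSCIrreducibleNodalOrigin.lean`, stratum `Δ_irr`): one vertex with
a LOOP, `Π` a pro-`Σ` completion `ι : Γ_{g,r} → Π` of the smoothing, node group `Π_ν = cl ι⟨b_0⟩` (the
non-separating vanishing cycle), cusp groups `cl ι⟨c_j⟩`.

By `nodalEdgeLikeCharacterization_of_containment` (`PSCEdgeLikeCharacterizationReduction.lean`) row F-1937
at such a datum needs only: `Π` topologically finitely generated (a completion of `Γ_{g,r}`), the node group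
procyclic (it is `cl⟨ι b_0⟩`) and INFINITE, and "containment determines the node" (one node).  The
infinitude is ABELIAN here: the handle character `b_0 ↦ 1 ∈ ℤ/ℓⁿ` (every other generator `↦ 0`;
abc-iut-f-164's `exists_handleCuspCharacter`) extends continuously to `Π`
(`TwoComponentAffine.exists_continuous_extend_zmod_pow`) and gives `ι(b_0)` order divisible by `ℓⁿ` for
every `n` (`infinite_topologicalClosure_map_zpowers_b`, stated for every handle `b_i`, every `g ≥ 1`, `r`).

Results: `nodalEdgeLikeCharacterization_of_irreducibleNodal` (row F-1937's datum-level statement at every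
datum whose nodes are all equal with node group `cl ι⟨b_0⟩` — whatever the vertices and cusps; NON-VACUOUS
when `r = 0`), `nodalEdgeLikeCharacterizationHolds_of_irreducibleNodal` (**F-1937 at every origin of
irreducible one-nodal data, f-164's shape hypothesis VERBATIM** — so it joins F-0459 / F-1931 / F-0458 of
`PSCIrreducibleNodalOrigin.lean` there), and `exists_irreducibleNodalOrigin_rmk123v_holds`: that origin,
INHABITED for every nonempty `Σ`, every `g ≥ 1` and `r` with `2 ≤ g ∨ 2 ≤ r` — in particular by the
NONCUSPIDAL irreducible one-nodal curves of arithmetic genus `g ≥ 2` (`r = 0`, where the `IsNoncuspidal`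
guard of F-1937 is met) — satisfies `NodalEdgeLikeCharacterizationHolds` ∧
`OpenInterDeterminesComponentHolds`.  Honest scope: instance forms at data of the shape of genuine curves
(the specialisation isomorphism is a hypothesis on the shape); consistency evidence for the typed row, not
the printed theorem for all pointed stable curves.  Nothing here takes a side on [IUTchIII] Cor. 3.12.
[cite: MochizukiCombGC2007, Prop 1.2(i) p.8] [cite: MochizukiSemiAnbd2006, Ex. 2.10 p.31]
-/

noncomputable section

namespace Literature.AnabelianGeometry.SemiGraphs

namespace PSCDatum

open scoped Pointwise
open Multiplicative
open Literature.GroupTheory.CombinatorialGroupTheory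
open Literature.AnabelianGeometry.AbsoluteAnabelian (IsTopologicallyFinitelyGenerated)
open SemiGraphOfAnabelioids (IsProSigmaCompletion)

universe u

section Handle

variable {P : Type u} [Group P] [TopologicalSpace P] [IsTopologicalGroup P] [CompactSpace P]
  [TotallyDisconnectedSpace P] {Sigma : Set ℕ} {g r : ℕ}

/-- **Handle loops have infinite order in every pro-`Σ` completion of `Γ_{g,r}`**: the closed procyclic
subgroup `cl ι⟨b_i⟩` is INFINITE (`ℓ ∈ Σ` prime).  The handle character `b_i ↦ 1 ∈ ℤ/ℓⁿ` (abc-iut-f-164's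
`exists_handleCuspCharacter`) extends continuously to `Π` and gives `ι(b_i)` an image of order `ℓⁿ`, for
every `n`. [cite: MochizukiSemiAnbd2006, Ex. 2.10 p.31] -/
theorem infinite_topologicalClosure_map_zpowers_b {ι : PuncturedSurfaceGroup g r →* P}
    (hι : IsProSigmaCompletion Sigma ι) {ℓ : ℕ} (hℓ : ℓ.Prime) (hℓS : ℓ ∈ Sigma) (i : Fin g) :
    ((((Subgroup.zpowers (PuncturedSurfaceGroup.b (r := r) i)).map ι).topologicalClosure :
      Subgroup P) : Set P).Infinite := by
  classical
  have key : ¬ IsOfFinOrder (ι (PuncturedSurfaceGroup.b (r := r) i)) := by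
    intro hfin
    obtain ⟨d, hd⟩ : ∃ d : ℕ, orderOf (ι (PuncturedSurfaceGroup.b (r := r) i)) = d := ⟨_, rfl⟩
    have hdpos : 0 < d := hd ▸ hfin.orderOf_pos
    -- the handle character `b_i ↦ 1`, all other generators `↦ 0`
    obtain ⟨φ, -, hφb, -⟩ := PuncturedSurfaceGroup.exists_handleCuspCharacter (g := g) (r := r)
      (n := ℓ ^ d) (fun _ => 0) (fun j => if j = i then 1 else 0) (fun _ => 0) (by simp)
    obtain ⟨χ, -, hχ⟩ := TwoComponentAffine.exists_continuous_extend_zmod_pow hι hℓ hℓS d φ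
    have h1 : χ (ι (PuncturedSurfaceGroup.b (r := r) i)) = ofAdd 1 := by
      rw [hχ, hφb, if_pos rfl]
    have hord : orderOf (χ (ι (PuncturedSurfaceGroup.b (r := r) i))) = ℓ ^ d := by
      rw [h1, orderOf_ofAdd_eq_addOrderOf, ZMod.addOrderOf_one]
    have hdvd : ℓ ^ d ∣ d := by
      have := orderOf_map_dvd χ (ι (PuncturedSurfaceGroup.b (r := r) i))
      rwa [hord, hd] at this
    exact absurd (Nat.le_of_dvd hdpos hdvd) (not_le.mpr (Nat.lt_pow_self hℓ.one_lt))
  rw [MonoidHom.map_zpowers]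
  exact (infinite_zpowers.mpr key).mono (Subgroup.le_topologicalClosure _)

end Handle

/-! ### Row F-1937 at the irreducible one-nodal shape -/

section Shape

variable {P : Type u} [Group P] [TopologicalSpace P] [IsTopologicalGroup P] [CompactSpace P]
  [TotallyDisconnectedSpace P] {Sigma : Set ℕ} {g r : ℕ}

/-- **[IUTchI] Rmk. 1.2.3 (v) as typed (`NodalEdgeLikeCharacterization`, row F-1937's datum-level
statement) HOLDS at every datum of irreducible one-nodal shape**: `Π` profinite, a pro-`Σ` completion
`ι : Γ_{g,r} → Π` (`g ≥ 1`), all nodes equal to one node `n₀` with `Π_{n₀} = cl ι⟨b_0⟩` (whatever the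
vertices and cusps; non-vacuous exactly when `r = 0`).  By `nodalEdgeLikeCharacterization_of_containment`.
[cite: Mochizuki2012, IUTchI Rmk 1.2.3(v) p.43] -/
theorem nodalEdgeLikeCharacterization_of_irreducibleNodal (G : PSCDatum P) (hne : Sigma.Nonempty)
    (hprime : ∀ p ∈ Sigma, p.Prime) (hg : 1 ≤ g) (ι : PuncturedSurfaceGroup g r →* P)
    (hι : IsProSigmaCompletion Sigma ι) (n₀ : G.graph.N) (hN : ∀ n, n = n₀)
    (hE : G.nodeGp n₀ =
      ((Subgroup.zpowers (PuncturedSurfaceGroup.b (r := r) (⟨0, hg⟩ : Fin g))).map ι).topologicalClosure) :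
    G.NodalEdgeLikeCharacterization := by
  obtain ⟨ℓ, hℓS⟩ := hne
  have hℓ : ℓ.Prime := hprime ℓ hℓS
  refine G.nodalEdgeLikeCharacterization_of_containment
    (IsProSigmaCompletion.isTopologicallyFinitelyGenerated_of_puncturedSurfaceGroup (MulEquiv.refl _) hι)
    (fun e => ?_) (fun e => ?_) (fun e e' _ _ _ => by rw [hN e, hN e'])
  · rw [hN e, hE, MonoidHom.map_zpowers]
    exact ⟨_, rfl⟩
  · rw [hN e, hE]
    exact infinite_topologicalClosure_map_zpowers_b hι hℓ hℓS _

end Shape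

/-! ### Origin level: F-1937 at every origin of irreducible one-nodal data (f-164's shape verbatim) -/

section Origin

variable (Ω : PSCOrigin.{u})

/-- **Row F-1937 (`NodalEdgeLikeCharacterizationHolds Ω`) HOLDS at every origin whose data are of
irreducible one-nodal shape** — abc-iut-f-164's shape hypothesis of
`openInterDeterminesComponentHolds_of_irreducibleNodal` VERBATIM (so F-0459, F-1931, F-0458 and F-1937 all
hold there). [cite: Mochizuki2012, IUTchI Rmk 1.2.3(v) p.43] -/
theorem nodalEdgeLikeCharacterizationHolds_of_irreducibleNodal
    (hΩ : ∀ ⦃Q : Type u⦄ [Group Q] [TopologicalSpace Q] [IsTopologicalGroup Q] (G : PSCDatum Q),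
      Ω.IsOfPSCType G → CompactSpace Q ∧ T2Space Q ∧ TotallyDisconnectedSpace Q ∧
        ∃ (S : Set ℕ) (g r : ℕ) (hg : 1 ≤ g) (ι : PuncturedSurfaceGroup g r →* Q) (e : G.graph.C ≃ Fin r)
          (v₀ : G.graph.V) (n₀ : G.graph.N),
          S.Nonempty ∧ (∀ p ∈ S, p.Prime) ∧ IsProSigmaCompletion S ι ∧ (2 ≤ g ∨ 2 ≤ r) ∧
          (∀ c, G.cuspGp c =
            ((PuncturedSurfaceGroup.cuspInertia (g := g) (e c)).map ι).topologicalClosure) ∧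
          (∀ w, w = v₀) ∧ (∀ n, n = n₀) ∧
          G.nodeGp n₀ = ((Subgroup.zpowers (PuncturedSurfaceGroup.b (r := r) (⟨0, hg⟩ : Fin g))).map
            ι).topologicalClosure ∧
          G.vertGp v₀ = ((Subgroup.closure {x : PuncturedSurfaceGroup g r |
            x = PuncturedSurfaceGroup.b ⟨0, hg⟩ ∨
            x = PuncturedSurfaceGroup.a ⟨0, hg⟩ * PuncturedSurfaceGroup.b ⟨0, hg⟩ * (PuncturedSurfaceGroup.a ⟨0, hg⟩)⁻¹ ∨
            (∃ i : Fin g, 1 ≤ (i : ℕ) ∧ (x = PuncturedSurfaceGroup.a i ∨ x = PuncturedSurfaceGroup.b i)) ∨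
            ∃ j : Fin r, x = PuncturedSurfaceGroup.c j}).map ι).topologicalClosure ∧
          G.genus v₀ = g - 1) :
    NodalEdgeLikeCharacterizationHolds Ω := by
  intro Q _ _ _ G hG
  obtain ⟨hc, -, hd, S, g, r, hg, ι, e, v₀, n₀, hne, hprime, hι, -, -, -, hN, hE, -, -⟩ := hΩ G hG
  haveI := hc
  haveI := hd
  exact G.nodalEdgeLikeCharacterization_of_irreducibleNodal hne hprime hg ι hι n₀ hN hE

/-- **An origin of irreducible one-nodal data at which F-1937 (`NodalEdgeLikeCharacterizationHolds`) and
F-0459 (`OpenInterDeterminesComponentHolds`) HOLD, INHABITED by abc-iut-f-164's genuine data** for every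
nonempty set of primes `Σ`, every `g ≥ 1` and every `r` with `2 ≤ g ∨ 2 ≤ r` (`exists_irreducibleNodalDatum`)
— in particular by the NONCUSPIDAL irreducible one-nodal curves (`r = 0`, `g ≥ 2`: `i = 1`, `n = 1`,
`r = 0`, the node group nodal), at which the `IsNoncuspidal` guard of F-1937 is met.  Second kernel
instance of [IUTchI] Rmk. 1.2.3 (v) at data WITH a node (after the two-component closed shape).
[cite: Mochizuki2012, IUTchI Rmk 1.2.3(v) p.43] [cite: MochizukiCombGC2007, Prop 1.2(i) p.8] -/
theorem exists_irreducibleNodalOrigin_rmk123v_holds :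
    ∃ Ω : PSCOrigin.{0},
      (∀ (S : Set ℕ), S.Nonempty → (∀ p ∈ S, p.Prime) → ∀ g r : ℕ, 1 ≤ g → (2 ≤ g ∨ 2 ≤ r) →
        ∃ (Q : ProfiniteGrp.{0}) (ι : PuncturedSurfaceGroup g r →* Q) (G : PSCDatum Q),
          IsProSigmaCompletion S ι ∧ Ω.IsOfPSCType G ∧ G.Sigma = S ∧ G.graph.i = 1 ∧ G.graph.n = 1 ∧
          G.graph.r = r ∧ (r = 0 → G.graph.IsNoncuspidal) ∧
          ∃ n₀ : G.graph.N, G.IsNodal (G.nodeGp n₀)) ∧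
      NodalEdgeLikeCharacterizationHolds Ω ∧ OpenInterDeterminesComponentHolds Ω := by
  classical
  -- the origin: f-164's irreducible one-nodal shape, profinite carriers
  let Ω : PSCOrigin.{0} :=
    ⟨fun {Q} _ _ G => ∃ (_ : IsTopologicalGroup Q),
      CompactSpace Q ∧ T2Space Q ∧ TotallyDisconnectedSpace Q ∧
        ∃ (S : Set ℕ) (g r : ℕ) (hg : 1 ≤ g) (ι : PuncturedSurfaceGroup g r →* Q) (e : G.graph.C ≃ Fin r)
          (v₀ : G.graph.V) (n₀ : G.graph.N),
          S.Nonempty ∧ (∀ p ∈ S, p.Prime) ∧ IsProSigmaCompletion S ι ∧ (2 ≤ g ∨ 2 ≤ r) ∧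
          (∀ c, G.cuspGp c =
            ((PuncturedSurfaceGroup.cuspInertia (g := g) (e c)).map ι).topologicalClosure) ∧
          (∀ w, w = v₀) ∧ (∀ n, n = n₀) ∧
          G.nodeGp n₀ = ((Subgroup.zpowers (PuncturedSurfaceGroup.b (r := r) (⟨0, hg⟩ : Fin g))).map
            ι).topologicalClosure ∧
          G.vertGp v₀ = ((Subgroup.closure {x : PuncturedSurfaceGroup g r |
            x = PuncturedSurfaceGroup.b ⟨0, hg⟩ ∨
            x = PuncturedSurfaceGroup.a ⟨0, hg⟩ * PuncturedSurfaceGroup.b ⟨0, hg⟩ * (PuncturedSurfaceGroup.a ⟨0, hg⟩)⁻¹ ∨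
            (∃ i : Fin g, 1 ≤ (i : ℕ) ∧ (x = PuncturedSurfaceGroup.a i ∨ x = PuncturedSurfaceGroup.b i)) ∨
            ∃ j : Fin r, x = PuncturedSurfaceGroup.c j}).map ι).topologicalClosure ∧
          G.genus v₀ = g - 1⟩
  have hΩ : ∀ ⦃Q : Type⦄ [Group Q] [TopologicalSpace Q] [IsTopologicalGroup Q] (G : PSCDatum Q),
      Ω.IsOfPSCType G → CompactSpace Q ∧ T2Space Q ∧ TotallyDisconnectedSpace Q ∧
        ∃ (S : Set ℕ) (g r : ℕ) (hg : 1 ≤ g) (ι : PuncturedSurfaceGroup g r →* Q) (e : G.graph.C ≃ Fin r)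
          (v₀ : G.graph.V) (n₀ : G.graph.N),
          S.Nonempty ∧ (∀ p ∈ S, p.Prime) ∧ IsProSigmaCompletion S ι ∧ (2 ≤ g ∨ 2 ≤ r) ∧
          (∀ c, G.cuspGp c =
            ((PuncturedSurfaceGroup.cuspInertia (g := g) (e c)).map ι).topologicalClosure) ∧
          (∀ w, w = v₀) ∧ (∀ n, n = n₀) ∧
          G.nodeGp n₀ = ((Subgroup.zpowers (PuncturedSurfaceGroup.b (r := r) (⟨0, hg⟩ : Fin g))).map
            ι).topologicalClosure ∧
          G.vertGp v₀ = ((Subgroup.closure {x : PuncturedSurfaceGroup g r |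
            x = PuncturedSurfaceGroup.b ⟨0, hg⟩ ∨
            x = PuncturedSurfaceGroup.a ⟨0, hg⟩ * PuncturedSurfaceGroup.b ⟨0, hg⟩ * (PuncturedSurfaceGroup.a ⟨0, hg⟩)⁻¹ ∨
            (∃ i : Fin g, 1 ≤ (i : ℕ) ∧ (x = PuncturedSurfaceGroup.a i ∨ x = PuncturedSurfaceGroup.b i)) ∨
            ∃ j : Fin r, x = PuncturedSurfaceGroup.c j}).map ι).topologicalClosure ∧
          G.genus v₀ = g - 1 :=
    fun Q _ _ _ G hG => hG.2
  refine ⟨Ω, fun S hne hprime g r hg hgr => ?_, nodalEdgeLikeCharacterizationHolds_of_irreducibleNodal Ω hΩ,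
    openInterDeterminesComponentHolds_of_irreducibleNodal Ω hΩ⟩
  -- inhabited by f-164's genuine irreducible one-nodal datum
  obtain ⟨Q, ι, G, e, v₀, n₀, hι, hS, hi, hn, hr, hC, hV, hN, hE, hVert, hgen, -⟩ :=
    exists_irreducibleNodalDatum S hne hprime g r hg
  refine ⟨Q, ι, G, hι, ⟨inferInstance, inferInstance, inferInstance, inferInstance, S, g, r, hg, ι, e, v₀,
    n₀, hne, hprime, hι, hgr, hC, hV, hN, hE, hVert, hgen⟩, hS, hi, hn, hr,
    fun hr0 => show G.graph.r = 0 from hr.trans hr0, ⟨n₀, ⟨n₀, 1, (one_smul _ _).symm⟩⟩⟩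

end Origin

end PSCDatum

end Literature.AnabelianGeometry.SemiGraphs

end
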